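import Literature.NumberTheory.IwasawaTheory.ClassNumberPExpSuccEqOfCardFixedLeTrivialBase
import Literature.NumberTheory.IwasawaTheory.ClassGroupPRankLeOneOfAmbiguousLayerTwo
import Literature.NumberTheory.IwasawaTheory.ClassicalMuVanishesReflectionLayer
import HarnessLib

/-!
# The PRO-CYCLIC DOOR at `p = 2`: over a base with `2 ∤ h_K`, `4 ∣ h(K_1)` AND `4 ∤ #Cl(K_2)^{Gal(K_2/K)}` force
# `rank₂ Cl(K_m) ≤ 1` for every `m`, `μ₂ = 0`, `λ₂ ≤ 1` — the mirror image of the depth door, proved on the class group itself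

Topic `NumberTheory/IwasawaTheory` (namespace = path).  THEOREM-ONLY file (no definition, no named fact, no instance, no `sorry`), written by the
prover seat `bsd-line-att-p3` g46 (cell `bsd-f1-sign2`, route `AlignedTransportAtTwo`; `--supports` stmt-BirchSwinnertonDyer-22298, closes nothing; no class group
is computed here).  Companion of `ClassGroupPRankLeOneOfAmbiguousLayerTwo.lean` (this seat g42, the DEPTH DOOR: `e_1 ≤ 1` and `4 ∣ #Cl(K_2)^G` ⟹ `rank₂ ≤ 1`).

THE DOOR (`classGroupPRank_two_le_one_of_two_le_of_not_four_dvd`; every layer / `μ₂`, `λ₂` and Chevalley's currency in the sequel `…OfNonNormUnitLayerTwo`).  `κ` a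
`ℤ₂`-extension of the number field `K` with Fukuda index `0` (`TotallyRamifiedFrom κ 0`), `2 ∤ h_K`, **`2 ≤ ord₂ h(K_1)`** and **`4 ∤ #{c ∈ Cl(K_2) : τc = c ∀ τ}`**.
THEN `rank₂ Cl(K_2) ≤ 1`, hence (small-rank criterion L10 at `j = 2`) `rank₂ Cl(K_m) ≤ 1` for every `m`, `μ₂(κ) = 0` and `λ₂(κ) ≤ 1`.

IN `Λ`-TERMS (Washington §13.3; `A_0 = 0` makes `X = Λ/J` cyclic, `#X/TX = #A_2^Γ`, `A_1 = ℤ₂/J(−2)`): `#X/TX = 2` says some `j ∈ J` has `v₂(j(0)) = 1`; `4 ∣ #A_1` says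
`J(−2) ⊆ 4ℤ₂`; by Weierstrass preparation such a `j` is a unit times `T − a`, `v₂(a) = 1` (a distinguished factor of degree `≥ 2`, or the constant `2`, would give
`v₂(j(−2)) = 1`), so **`X` is a quotient of `Λ/(T − a) ≅ ℤ₂`: pro-cyclic, `μ = 0`, `λ ≤ 1`**.  The depth door is the case `v₂(j(−2)) = 1`, `J(0) ⊆ 4ℤ₂`; the two are
exchanged by `T + 1 ↦ −(T + 1)`, and the algebra brick below IS g42's depth lemma applied to `−φ`.

PROOF AT FINITE LEVEL, ON THE CLASS GROUP (no Fukuda package: the tree's equivariant Artin export `Fukuda1994Thm1RankPackageFixed` bounds the abstract fixed points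
only from BELOW; this door needs them bounded from ABOVE).  `γ` a topological generator, `σ = γ|_{K_2}`, `σ₁ = γ|_{K_1}`, `P = Cl(K_2)[2^∞]`, `N = N_{K_2/K_1}`:
(1) `#P^σ ≤ 2` (a `2`-subgroup of the fixed classes); (2) `(1+σ)P ⊆ ker N`: `N(c·σc) = N c · σ₁ N c` (the norm is `Γ`-equivariant, tree
`classGroupNorm_layer_layer_mulEquiv_intAut_absRestrictNormalHom`) and `y·σ₁y = i(N_{K_1/K} y)` (Neukirch (1.6)(iv), tree `classGroupExtend_classGroupNorm_eq_prod`) is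
trivial on `2`-primary `y` as `2 ∤ h_K`; (3) `N` is onto (tree `classGroupNorm_layer_succ_surjective`), so `#P/(1+σ)P ≥ #Cl(K_1)[2^∞] ≥ 4`; (4) the algebra brick
`#ker(φ−1) ≤ 2 ∧ #M/(1+φ)M ≥ 4 ⟹ #M/2M ≤ 2` gives `#Cl(K_2)[2] ≤ 2`, i.e. `rank₂ Cl(K_2) ≤ 1` (tree dictionary `natCard_torsion_classGroup_layer_eq`).
Chevalley's currency for `4 ∤ #Cl(K_2)^G` (two ramified primes and ONE unit of `K` outside `N_{K_2/K} K_2ˣ`) is the sequel `ClassGroupPRankLeOneOfNonNormUnitLayerTwo`.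

USE (cell bsd-f1-sign2, crux C2; complex cubic `F = ℚ(β)`, `h_F` odd, `Δ_W ≡ 5 (8)`, `2 = 𝔭₁𝔭₂`, `t` = exact `2`-adic depth of `ε_F` at `𝔭₁`): habitat **`t = 3 ∧ e_1 ≥ 2`**
(e.g. `N = 12163`, census `e_1 = 2`), where the depth door (`t ≥ 4`), Chevalley (`t = 2`), the layer-one/two unit doors and the capitulation door are all silent.
HONEST SCOPE: classical (Washington §13.3 read at finite level + Neukirch (1.6)(iv) + Fukuda); nothing specific to any summit; BSD is not advanced by this file.
Not found in print in this form (corpus hybrid/vsearch: Washington §13.3, Lang Ch. 13 §4, Fukuda 1994; galaxy: Greenberg-conjecture literature for totally real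
fields) — ingredients cited at each use (D-0014).

References: [Washington1997] §13.3 Lemmas 13.15, 13.18, Prop. 13.22–13.23, Thm. 13.13; [Fukuda1994] Thm. 1 (2), p. 264; [Lang1990] Ch. 13 §4 Lemma 4.1 (PDF pp. 203–204),
Ch. 5 §2 (Weierstrass preparation); [NeukirchANT1999] Ch. III §1 Prop. (1.6) (iv), Ch. I §9 Prop. (9.6).
-/

set_option autoImplicit false

noncomputable section
open Finset NumberField IsDedekindDomain Field IntermediateField
open scoped NumberField

/-! ## §1 The algebra brick: g42's depth lemma applied to `−φ` -/

namespace Literature.NumberTheory.IwasawaTheory.FukudaDepth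

variable {M : Type*} [AddCommGroup M] [Finite M]

/-- `#(X/f(X)) = #ker f` for an endomorphism `f` of a finite abelian group (`X/ker f ≅ f(X)`). [folklore] -/
private theorem card_quotient_range_eq_card_ker' (f : Module.End ℤ M) :
    Nat.card (M ⧸ LinearMap.range f) = Nat.card (LinearMap.ker f) := by
  have h1 : Nat.card (LinearMap.ker f) * Nat.card (LinearMap.range f) = Nat.card M := by
    rw [← Nat.card_congr (LinearMap.quotKerEquivRange f).toEquiv]
    exact (Submodule.card_eq_card_quotient_mul_card (LinearMap.ker f)).symm
  have h2 : Nat.card (LinearMap.range f) * Nat.card (M ⧸ LinearMap.range f) = Nat.card M :=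
    (Submodule.card_eq_card_quotient_mul_card (LinearMap.range f)).symm
  have hpos : 0 < Nat.card (LinearMap.range f) := Nat.card_pos
  apply Nat.eq_of_mul_eq_mul_left hpos
  rw [h2, ← h1, mul_comm]

/-- ★★ **THE PRO-CYCLIC LEMMA (`p = 2`).**  `M` a finite abelian group of `2`-power order, `φ ∈ End_ℤ(M)` with `φ^{2^t} = 1` (`t ≥ 1`),
`#ker(φ − 1) ≤ 2` and `#(M/(1+φ)M) ≥ 4`.  Then **`#(M/2M) ≤ 2`** (`M` is cyclic).  This is the depth lemma `card_quotient_map_two_le_two_of_ker` for `ψ = −φ`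
(`(1+ψ)M = (φ−1)M` has order `#M/#ker(φ−1)`, `ker(ψ−1) = ker(1+φ)` has order `#(M/(1+φ)M)`, `ψ^{2^t} = φ^{2^t}`).  In `Λ`-terms: `v₂(j(0)) = 1` and `J(−2) ⊆ 4ℤ₂`
force `j = (T − a)·unit`, `v₂(a) = 1`. [cite: Washington1997, §13.3 Lemmas 13.15, 13.18 and Prop. 13.22] [cite: Lang1990, Ch. 5 §2 (Weierstrass preparation)] -/
theorem card_quotient_map_two_le_two_of_card_ker_le (hM : ∃ a : ℕ, Nat.card M = 2 ^ a) (φ : Module.End ℤ M) {t : ℕ} (ht : 1 ≤ t)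
    (hφ : φ ^ 2 ^ t = 1) (h1 : Nat.card (LinearMap.ker (φ - 1)) ≤ 2)
    (h2 : 4 ≤ Nat.card (M ⧸ (⊤ : Submodule ℤ M).map (1 + φ))) :
    Nat.card (M ⧸ (⊤ : Submodule ℤ M).map ((2 : ℤ) • (1 : Module.End ℤ M))) ≤ 2 := by
  have heven : Even (2 ^ t) := by
    obtain ⟨s, rfl⟩ := Nat.exists_eq_add_of_le ht
    rw [pow_add, pow_one]; exact even_two_mul _
  have hψ : (-φ) ^ 2 ^ t = 1 := by rw [heven.neg_pow, hφ]
  have h1' : Nat.card (M ⧸ (⊤ : Submodule ℤ M).map (1 + -φ)) ≤ 2 := by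
    have heq : (⊤ : Submodule ℤ M).map (1 + -φ) = (⊤ : Submodule ℤ M).map (φ - 1) := by
      rw [show (1 + -φ : Module.End ℤ M) = -(φ - 1) by abel, Submodule.map_neg]
    rw [heq, Submodule.map_top, card_quotient_range_eq_card_ker']
    exact h1
  have h2' : 4 ≤ Nat.card (LinearMap.ker (-φ - 1)) := by
    have heq : LinearMap.ker (-φ - 1) = LinearMap.ker (1 + φ) := by
      rw [show (-φ - 1 : Module.End ℤ M) = -(1 + φ) by abel, LinearMap.ker_neg]
    rw [heq, ← card_quotient_range_eq_card_ker', ← Submodule.map_top]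
    exact h2
  exact card_quotient_map_two_le_two_of_ker hM (-φ) hψ h1' h2'

end Literature.NumberTheory.IwasawaTheory.FukudaDepth

/-! ## §2 The group-theoretic door: a finite commutative group with an automorphism of order dividing `4` -/

namespace Literature.NumberTheory.IwasawaTheory

section Group

variable {G H : Type*} [CommGroup G] [Finite G] [CommGroup H] [Finite H]

omit [Finite H] in
/-- A `2`-primary element of `H` is the image of a `2`-PRIMARY element of `G` under a surjection `N : G → H`
(`a = a₀^{uv}`, `#G = 2^s u`, `u v ≡ 1 (mod 2^m)`). [folklore] -/
private theorem exists_primary_preimage_of_surjective (N : G →* H) (hN : Function.Surjective N) {m : ℕ} {b : H}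
    (hb : b ^ 2 ^ m = 1) : ∃ a : G, a ∈ CommGroup.primaryComponent G 2 ∧ N a = b := by
  classical
  haveI : Fintype G := Fintype.ofFinite G
  set h := Fintype.card G with hh
  have h0 : h ≠ 0 := Fintype.card_ne_zero
  set s := h.factorization 2 with hs
  set u := h / 2 ^ s with hu
  have hpu : Nat.Coprime u (2 ^ m) := (Nat.coprime_ordCompl Nat.prime_two h0).symm.pow_right m
  have hhu : 2 ^ s * u = h := Nat.ordProj_mul_ordCompl_eq_self h 2
  obtain ⟨a₀, rfl⟩ := hN b
  rcases Nat.lt_or_ge 1 (2 ^ m) with hm | hm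
  · obtain ⟨v, -, hv⟩ := Nat.exists_mul_mod_eq_one_of_coprime hpu hm
    refine ⟨a₀ ^ (u * v), (CommGroup.mem_primaryComponent).mpr ⟨s, ?_⟩, ?_⟩
    · rw [← pow_mul, mul_comm (u * v), ← mul_assoc, hhu, pow_mul, hh, pow_card_eq_one, one_pow]
    · rw [map_pow]
      have huv : u * v = 2 ^ m * (u * v / 2 ^ m) + 1 := by
        have := Nat.div_add_mod (u * v) (2 ^ m); rw [hv] at this; exact this.symm
      rw [huv, pow_add, pow_one, pow_mul, hb, one_pow, one_mul]
  · have hm1 : 2 ^ m = 1 := le_antisymm hm Nat.one_le_two_pow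
    rw [hm1, pow_one] at hb
    exact ⟨1, Subgroup.one_mem _, by rw [map_one, hb]⟩

/-- ★★ **The pro-cyclic door for a finite commutative group.**  `α` an automorphism of `G` with `α⁴ = 1` whose fixed points are NOT divisible by `4` in
number; `N : G ↠ H` onto a group of order divisible by `4`, killing `g·αg` for every `2`-primary `g`.  Then **`#{g : g² = 1} ≤ 2`** (the `2`-part of `G` is
cyclic): on `P = G[2^∞]`, `#P^α ≤ 2`, `#P/(1+α)P ≥ #N(P) = #H[2^∞] ≥ 4`, and the pro-cyclic lemma. [cite: Washington1997, §13.3 Lemma 13.18 and Prop. 13.22]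
[cite: Lang1990, Ch. 13 §4 Lemma 4.1] -/
theorem natCard_sq_eq_one_le_two_of_not_four_dvd_card_fixed (α : G ≃* G) (hα : ∀ g, α (α (α (α g))) = g)
    (hfix : ¬ 4 ∣ Nat.card {g : G // α g = g}) (N : G →* H) (hN : Function.Surjective N) (h4 : 4 ∣ Nat.card H)
    (hker : ∀ g : G, g ∈ CommGroup.primaryComponent G 2 → N (g * α g) = 1) :
    Nat.card {g : G // g ^ 2 = 1} ≤ 2 := by
  classical
  haveI : Fact (Nat.Prime 2) := ⟨Nat.prime_two⟩
  set P : Subgroup G := CommGroup.primaryComponent G 2 with hP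
  have hPmem : ∀ {g : G}, g ∈ P ↔ ∃ k : ℕ, g ^ 2 ^ k = 1 := fun {g} => CommGroup.mem_primaryComponent
  -- `α` restricted to `P`
  have hαP : ∀ g : P, α (g : G) ∈ P := fun g => by
    obtain ⟨k, hk⟩ := hPmem.mp g.2
    exact hPmem.mpr ⟨k, by rw [← map_pow, hk, map_one]⟩
  let αP : P →* P :=
    { toFun := fun g => ⟨α g, hαP g⟩
      map_one' := Subtype.ext (by simp)
      map_mul' := fun a b => Subtype.ext (by simp) }
  have hαP_apply : ∀ g : P, ((αP g : P) : G) = α g := fun _ => rfl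
  -- additive module `M = P`, `φ = α|_P`
  let φ : Module.End ℤ (Additive P) := (MonoidHom.toAdditive αP).toIntLinearMap
  have hφ_apply : ∀ x : Additive P, φ x = Additive.ofMul (αP (Additive.toMul x)) := fun _ => rfl
  have hφ4 : φ ^ 2 ^ 2 = 1 := by
    apply LinearMap.ext
    intro x
    rw [show (2 : ℕ) ^ 2 = 4 by norm_num, Module.End.one_apply]
    change φ (φ (φ (φ x))) = x
    apply Additive.toMul.injective
    apply Subtype.ext
    simp only [hφ_apply, toMul_ofMul, hαP_apply]
    exact hα _
  have hM : ∃ a : ℕ, Nat.card (Additive P) = 2 ^ a := (CommGroup.primaryComponent.isPGroup (G := G) (p := 2)).exists_card_eq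
  -- (1) `#ker(φ - 1) ≤ 2`
  have h1 : Nat.card (LinearMap.ker (φ - 1)) ≤ 2 := by
    -- the fixed subgroup of `α`
    let Fix : Subgroup G :=
      { carrier := {g | α g = g}
        mul_mem' := fun {a b} ha hb => by
          simp only [Set.mem_setOf_eq] at ha hb ⊢
          rw [map_mul, ha, hb]
        one_mem' := by simp
        inv_mem' := fun {a} ha => by
          simp only [Set.mem_setOf_eq] at ha ⊢
          rw [map_inv, ha] }
    have hFix : Nat.card Fix = Nat.card {g : G // α g = g} := Nat.card_congr (Equiv.subtypeEquivRight fun _ => Iff.rfl)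
    -- `ker(φ-1) ≃ P ⊓ Fix`
    have hiff : ∀ x : Additive P, x ∈ LinearMap.ker (φ - 1) ↔ ((Additive.toMul x : P) : G) ∈ P ⊓ Fix := by
      intro x
      rw [LinearMap.mem_ker, LinearMap.sub_apply, Module.End.one_apply, sub_eq_zero, Subgroup.mem_inf]
      constructor
      · intro h
        refine ⟨(Additive.toMul x).2, ?_⟩
        change α ((Additive.toMul x : P) : G) = _
        have := congrArg (fun y : Additive P => ((Additive.toMul y : P) : G)) h
        simpa only [hφ_apply, toMul_ofMul, hαP_apply] using this
      · rintro ⟨-, h⟩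
        change α ((Additive.toMul x : P) : G) = ((Additive.toMul x : P) : G) at h
        apply Additive.toMul.injective
        exact Subtype.ext (by simp only [hφ_apply, toMul_ofMul, hαP_apply, h])
    let e : LinearMap.ker (φ - 1) ≃ (P ⊓ Fix : Subgroup G) :=
      { toFun := fun x => ⟨((Additive.toMul (x : Additive P) : P) : G), (hiff x.1).mp x.2⟩
        invFun := fun g => ⟨Additive.ofMul ⟨(g : G), (Subgroup.mem_inf.mp g.2).1⟩, (hiff _).mpr (by simp only [toMul_ofMul]; exact g.2)⟩
        left_inv := fun x => by apply Subtype.ext; apply Additive.toMul.injective; exact Subtype.ext rfl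
        right_inv := fun g => Subtype.ext rfl }
    rw [Nat.card_congr e]
    -- `#(P ⊓ Fix)` is a power of `2` dividing `#Fix`
    obtain ⟨n, hn⟩ := ((CommGroup.primaryComponent.isPGroup (G := G) (p := 2)).to_le
      (inf_le_left : P ⊓ Fix ≤ P)).exists_card_eq
    have hdvd : Nat.card (P ⊓ Fix : Subgroup G) ∣ Nat.card Fix := Subgroup.card_dvd_of_le inf_le_right
    rw [hn, hFix] at hdvd
    rw [hn]
    rcases Nat.lt_or_ge n 2 with hn2 | hn2
    · interval_cases n <;> norm_num
    · exact absurd ((pow_dvd_pow 2 hn2).trans hdvd) hfix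
  -- (3) `#(M/(1+φ)M) ≥ 4`
  have h2 : 4 ≤ Nat.card (Additive P ⧸ (⊤ : Submodule ℤ (Additive P)).map (1 + φ)) := by
    -- the norm restricted to `P`, as a linear map
    let NP : Additive P →ₗ[ℤ] Additive H := (MonoidHom.toAdditive (N.comp P.subtype)).toIntLinearMap
    have hNP_apply : ∀ x : Additive P, NP x = Additive.ofMul (N ((Additive.toMul x : P) : G)) := fun _ => rfl
    -- `(1+φ)M ≤ ker NP`
    have hle : (⊤ : Submodule ℤ (Additive P)).map (1 + φ) ≤ LinearMap.ker NP := by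
      rintro _ ⟨x, -, rfl⟩
      rw [LinearMap.mem_ker, LinearMap.add_apply, Module.End.one_apply, hNP_apply]
      have hx : ((Additive.toMul (x + φ x) : P) : G) = ((Additive.toMul x : P) : G) * α ((Additive.toMul x : P) : G) := by
        rw [toMul_add, Subgroup.coe_mul, hφ_apply, toMul_ofMul, hαP_apply]
      rw [hx, hker _ (Additive.toMul x).2, ofMul_one]
    -- `#range NP ≥ 4`: every element of a Sylow `2`-subgroup of `H` is a value
    obtain ⟨Q⟩ : Nonempty (Sylow 2 H) := inferInstance
    have hQcard : 4 ∣ Nat.card Q := by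
      rw [Q.card_eq_multiplicity]
      have hne : Nat.card H ≠ 0 := Nat.card_pos.ne'
      have h22 : 2 ≤ (Nat.card H).factorization 2 :=
        (Nat.Prime.pow_dvd_iff_le_factorization Nat.prime_two hne).mp (by norm_num; exact h4)
      exact (pow_dvd_pow 2 h22).trans (by norm_num)
    have h4Q : 4 ≤ Nat.card Q := Nat.le_of_dvd Nat.card_pos hQcard
    have hrange : Nat.card Q ≤ Nat.card (LinearMap.range NP) := by
      let f : Q → LinearMap.range NP := fun q =>
        ⟨Additive.ofMul ((q : Q) : H), by
          obtain ⟨k, hk⟩ := Q.isPGroup' q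
          have hk' : ((q : Q) : H) ^ 2 ^ k = 1 := by
            have := congrArg (fun z : Q => (z : H)) hk
            simpa using this
          obtain ⟨a, haP, ha⟩ := exists_primary_preimage_of_surjective N hN hk'
          exact ⟨Additive.ofMul ⟨a, haP⟩, by rw [hNP_apply, toMul_ofMul, ha]⟩⟩
      have hf : Function.Injective f := fun a b hab => by
        have := congrArg (fun z : LinearMap.range NP => Additive.toMul (z : Additive H)) hab
        exact Subtype.ext (by simpa [f] using this)
      exact Nat.card_le_card_of_injective f hf
    -- `#(M/(1+φ)M) ≥ #(M/ker NP) = #range NP`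
    haveI : Finite (Additive P ⧸ (⊤ : Submodule ℤ (Additive P)).map (1 + φ)) :=
      Finite.of_surjective _ (Submodule.Quotient.mk_surjective _)
    have hq : Nat.card (Additive P ⧸ LinearMap.ker NP) ≤ Nat.card (Additive P ⧸ (⊤ : Submodule ℤ (Additive P)).map (1 + φ)) :=
      Nat.card_le_card_of_surjective (Submodule.mapQ _ (LinearMap.ker NP) LinearMap.id hle) (by
        rintro ⟨x⟩
        exact ⟨Submodule.Quotient.mk x, rfl⟩)
    rw [Nat.card_congr (LinearMap.quotKerEquivRange NP).toEquiv] at hq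
    exact (h4Q.trans hrange).trans hq
  -- (4) the pro-cyclic lemma
  have h3 := FukudaDepth.card_quotient_map_two_le_two_of_card_ker_le hM φ (t := 2) one_le_two hφ4 h1 h2
  -- `{g : g² = 1} ≃ ker (2 • 1 : End M)`
  set π : Module.End ℤ (Additive P) := (2 : ℤ) • 1 with hπ
  have hπ_apply : ∀ x : Additive P, π x = (2 : ℤ) • x := fun _ => rfl
  have hkerπ : Nat.card (LinearMap.ker π) = Nat.card (Additive P ⧸ (⊤ : Submodule ℤ (Additive P)).map π) := by
    rw [Submodule.map_top, FukudaDepth.card_quotient_range_eq_card_ker']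
  have hsq : ∀ {g : G}, g ^ 2 = 1 → g ∈ P := fun {g} hg => hPmem.mpr ⟨1, by rw [pow_one]; exact hg⟩
  have hiff2 : ∀ x : Additive P, x ∈ LinearMap.ker π ↔ ((Additive.toMul x : P) : G) ^ 2 = 1 := by
    intro x
    rw [LinearMap.mem_ker, hπ_apply, show ((2 : ℤ) • x = 0 ↔ (2 : ℕ) • x = 0) from by rw [← natCast_zsmul]; rfl]
    constructor
    · intro h
      have h' : (Additive.toMul x : P) ^ 2 = 1 := by
        have := congrArg Additive.toMul h
        rwa [toMul_nsmul, toMul_zero] at this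
      have := congrArg (fun z : P => (z : G)) h'
      simpa using this
    · intro h
      have h' : (Additive.toMul x : P) ^ 2 = 1 := Subtype.ext (by simpa using h)
      have := congrArg Additive.ofMul h'
      rwa [ofMul_pow, ofMul_toMul, ofMul_one] at this
  let e2 : {g : G // g ^ 2 = 1} ≃ LinearMap.ker π :=
    { toFun := fun g => ⟨Additive.ofMul ⟨(g : G), hsq g.2⟩, (hiff2 _).mpr (by simpa using g.2)⟩
      invFun := fun x => ⟨((Additive.toMul (x : Additive P) : P) : G), (hiff2 x.1).mp x.2⟩
      left_inv := fun g => Subtype.ext rfl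
      right_inv := fun x => by apply Subtype.ext; apply Additive.toMul.injective; exact Subtype.ext rfl }
  rw [Nat.card_congr e2, hkerπ]
  exact h3

end Group

/-! ## §3 The door in the `ℤ₂`-tower over a base with `2 ∤ h_K` (Fukuda index `0`) -/

section Door

open Literature.NumberTheory.EllipticCurves Literature.NumberTheory.NumberFields
  Literature.NumberTheory.GaloisRepresentations

variable {K : Type} [Field K] [NumberField K]

/-- ★★★ **THE PRO-CYCLIC DOOR (one layer).**  `κ` a `ℤ₂`-extension of the number field `K`, totally ramified at every ramified prime from `K` itself
(`TotallyRamifiedFrom κ 0`), with `2 ∤ h_K`, **`2 ≤ ord₂ h(K_1)`** and **`4 ∤ #{c ∈ Cl(K_2) : τc = c ∀ τ ∈ Gal(K_2/K)}`**.  THEN **`rank₂ Cl(K_2) ≤ 1`**.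
(Proof on `Cl(K_2)[2^∞]` with `σ = γ|_{K_2}`: fixed part of order `≤ 2`; `(1+σ)`-image inside `ker N_{K_2/K_1}` by `Γ`-equivariance of the norm and
`y·σ₁y = i(N_{K_1/K} y) = 1` on `2`-primary classes (`2 ∤ h_K`); `N` onto; the pro-cyclic lemma.) [cite: Washington1997, §13.3 Lemmas 13.15, 13.18 and Prop. 13.22]
[cite: NeukirchANT1999, Ch. III §1 Prop. (1.6) (iv)] [cite: Lang1990, Ch. 13 §4 Lemma 4.1] -/
theorem classGroupPRank_two_le_one_of_two_le_of_not_four_dvd (κ : ZpExtension K 2) (hκ : TotallyRamifiedFrom κ 0)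
    (hK : ¬ 2 ∣ classNumber K) (he1 : 2 ≤ classNumberPExp κ 1)
    (hfix : ¬ 4 ∣ Nat.card {c : ClassGroup (𝓞 (κ.layer 2)) //
        ∀ τ : (κ.layer 2) ≃ₐ[K] (κ.layer 2), ClassGroup.mulEquiv (AmbiguousClass.intAut τ) c = c}) :
    classGroupPRank κ 2 ≤ 1 := by
  classical
  haveI : Fact (Nat.Prime 2) := ⟨Nat.prime_two⟩
  -- the layers `K_1 ⊆ K_2`
  haveI : FiniteDimensional K (κ.layer 1) := κ.finiteDimensional_layer_holds 1
  haveI : FiniteDimensional K (κ.layer 2) := κ.finiteDimensional_layer_holds 2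
  haveI : NumberField (κ.layer 1) := NumberField.of_module_finite K _
  haveI : NumberField (κ.layer 2) := NumberField.of_module_finite K _
  haveI : IsGalois K (κ.layer 1) := κ.isGalois_layer_holds 1
  haveI : IsGalois K (κ.layer 2) := κ.isGalois_layer_holds 2
  haveI : Normal K (κ.layer 1) := IsGalois.to_normal
  haveI : Normal K (κ.layer 2) := IsGalois.to_normal
  have h12 : κ.layer 1 ≤ κ.layer 2 := κ.layer_mono one_le_two
  letI : Algebra (κ.layer 1) (κ.layer 2) := (IntermediateField.inclusion h12).toRingHom.toAlgebra
  haveI : IsScalarTower K (κ.layer 1) (κ.layer 2) :=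
    IsScalarTower.of_algebraMap_eq fun x => ((IntermediateField.inclusion h12).commutes x).symm
  -- a topological generator `γ`; `σ = γ|_{K_2}` (order `4`), `σ₁ = γ|_{K_1}` (order `2`)
  obtain ⟨γ, hγ⟩ : ∃ γ : absoluteGaloisGroup K, κ.IsTopGenerator γ := κ.surjective (Multiplicative.ofAdd 1)
  set σ : (κ.layer 2) ≃ₐ[K] (κ.layer 2) := absRestrictNormalHom (κ.layer 2) γ with hσ
  set σ₁ : (κ.layer 1) ≃ₐ[K] (κ.layer 1) := absRestrictNormalHom (κ.layer 1) γ with hσ₁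
  have hσgen : Subgroup.zpowers σ = ⊤ := zpowers_absRestrictNormalHom_layer_eq_top κ hγ 2
  have hσord : orderOf σ = 4 := by
    rw [hσ, orderOf_absRestrictNormalHom_layer κ hγ 2]; norm_num
  have hσ₁ord : orderOf σ₁ = 2 := by
    rw [hσ₁, orderOf_absRestrictNormalHom_layer κ hγ 1]; norm_num
  -- `α = σ` on `Cl(K_2)`
  let α : ClassGroup (𝓞 (κ.layer 2)) ≃* ClassGroup (𝓞 (κ.layer 2)) := ClassGroup.mulEquiv (AmbiguousClass.intAut σ)
  have hα : ∀ c, α c = ClassGroup.mulEquiv (AmbiguousClass.intAut σ) c := fun _ => rfl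
  have hα4 : ∀ c, α (α (α (α c))) = c := by
    intro c
    have h4 : σ * σ * σ * σ = 1 := by
      rw [← pow_one σ, ← pow_add, ← pow_add, ← pow_add, show 1 + 1 + 1 + 1 = orderOf (σ ^ 1) by rw [pow_one, hσord]]
      exact pow_orderOf_eq_one _
    have : ClassGroup.mulEquiv (AmbiguousClass.intAut (σ * σ * σ * σ)) c = α (α (α (α c))) := by
      simp only [AmbiguousClass.mulEquiv_intAut_mul, MulEquiv.trans_apply, hα]
    rw [← this, h4, AmbiguousClass.mulEquiv_intAut_one, MulEquiv.refl_apply]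
  -- the `σ`-fixed classes are the `Gal(K_2/K)`-fixed classes
  have hfixα : ¬ 4 ∣ Nat.card {c : ClassGroup (𝓞 (κ.layer 2)) // α c = c} := by
    have hcard : Nat.card {c : ClassGroup (𝓞 (κ.layer 2)) //
        ∀ τ : (κ.layer 2) ≃ₐ[K] (κ.layer 2), ClassGroup.mulEquiv (AmbiguousClass.intAut τ) c = c} =
        Nat.card {c : ClassGroup (𝓞 (κ.layer 2)) // α c = c} := by
      refine Nat.card_congr (Equiv.subtypeEquivRight fun c => ⟨fun h => h σ, fun h τ => ?_⟩)
      obtain ⟨k, rfl⟩ := Herbrand.exists_pow_eq_of_forall_mem_zpowers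
        (fun τ' => by rw [hσgen]; exact Subgroup.mem_top τ') τ
      induction k with
      | zero => rw [pow_zero, AmbiguousClass.mulEquiv_intAut_one, MulEquiv.refl_apply]
      | succ k ih => rw [pow_succ, AmbiguousClass.mulEquiv_intAut_mul, MulEquiv.trans_apply, ← hα, h, ih]
    rwa [hcard] at hfix
  -- the norm `N : Cl(K_2) → Cl(K_1)`, onto
  set N := classGroupNorm (κ.layer 1) (κ.layer 2) with hN
  have hNsurj : Function.Surjective N := classGroupNorm_layer_succ_surjective κ 1 hκ (Nat.zero_le 1)
  -- `4 ∣ #Cl(K_1)`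
  have h4 : 4 ∣ Nat.card (ClassGroup (𝓞 (κ.layer 1))) := by
    have hne : Nat.card (ClassGroup (𝓞 (κ.layer 1))) ≠ 0 := Nat.card_pos.ne'
    have h : 2 ^ 2 ∣ Nat.card (ClassGroup (𝓞 (κ.layer 1))) := by
      rw [padicValNat_dvd_iff_le hne, ← classNumberPExp_def]; exact he1
    simpa using h
  -- `(1+σ)` kills into `ker N` on `2`-primary classes
  have hker : ∀ g : ClassGroup (𝓞 (κ.layer 2)), g ∈ CommGroup.primaryComponent (ClassGroup (𝓞 (κ.layer 2))) 2 →
      N (g * α g) = 1 := by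
    intro g hg
    obtain ⟨k, hk⟩ := (CommGroup.mem_primaryComponent).mp hg
    rw [map_mul, hα, hN, classGroupNorm_layer_layer_mulEquiv_intAut_absRestrictNormalHom κ γ g, ← hσ₁]
    set y := classGroupNorm (κ.layer 1) (κ.layer 2) g with hy
    -- `Gal(K_1/K) = {1, σ₁}`
    have hne1 : (1 : (κ.layer 1) ≃ₐ[K] (κ.layer 1)) ≠ σ₁ := by
      intro h1
      have : orderOf σ₁ = 1 := by rw [← h1, orderOf_one]
      rw [hσ₁ord] at this
      exact absurd this (by norm_num)
    have huniv : ({1, σ₁} : Finset ((κ.layer 1) ≃ₐ[K] (κ.layer 1))) = Finset.univ := by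
      refine Finset.eq_univ_of_card _ ?_
      rw [Finset.card_pair hne1, ← Nat.card_eq_fintype_card, IsGalois.card_aut_eq_finrank, κ.finrank_layer_holds 1, pow_one]
    have hprod : y * ClassGroup.mulEquiv (AmbiguousClass.intAut σ₁) y =
        ∏ τ : (κ.layer 1) ≃ₐ[K] (κ.layer 1), ClassGroup.mulEquiv (AmbiguousClass.intAut τ) y := by
      rw [← huniv, Finset.prod_pair hne1, AmbiguousClass.mulEquiv_intAut_one, MulEquiv.refl_apply]
    rw [hprod, ← classGroupExtend_classGroupNorm_eq_prod K (κ.layer 1) y]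
    -- `N_{K_1/K} y` is a `2`-primary class of `K`, hence trivial
    have hz : classGroupNorm K (κ.layer 1) y ^ 2 ^ k = 1 := by
      rw [← map_pow, hy, ← map_pow, hk, map_one, map_one]
    have h1 : classGroupNorm K (κ.layer 1) y = 1 := by
      have hdvd1 : orderOf (classGroupNorm K (κ.layer 1) y) ∣ 2 ^ k := orderOf_dvd_of_pow_eq_one hz
      have hdvd2 : orderOf (classGroupNorm K (κ.layer 1) y) ∣ classNumber K := orderOf_dvd_card
      have hcop : Nat.Coprime (2 ^ k) (classNumber K) :=
        Nat.Coprime.pow_left k ((Nat.Prime.coprime_iff_not_dvd Nat.prime_two).mpr hK)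
      have h := Nat.dvd_gcd hdvd1 hdvd2
      rw [hcop, Nat.dvd_one] at h
      exact orderOf_eq_one_iff.mp h
    rw [h1, map_one]
  -- the group-theoretic door, and the dictionary `#Cl(K_2)[2] = 2^{rank₂}`
  have h := natCard_sq_eq_one_le_two_of_not_four_dvd_card_fixed α hα4 hfixα N hNsurj h4 hker
  rw [natCard_torsion_classGroup_layer_eq κ 2] at h
  have h1 : 2 ^ classGroupPRank κ 2 ≤ 2 ^ 1 := by rw [pow_one]; exact h
  exact (Nat.pow_le_pow_iff_right (by norm_num)).mp h1

end Door

end Literature.NumberTheory.IwasawaTheory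

end
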